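import Literature.AlgebraicGeometry.Frobenioids.BirationalizationProp44UnitsProofs
import Literature.AlgebraicGeometry.Frobenioids.BiratUnitsTransport
import Literature.AlgebraicGeometry.Frobenioids.BiratPathsDiv
import Literature.AlgebraicGeometry.Frobenioids.ModelFrobenioidComparisonFull2
import HarnessLib

/-!
# Frobenioids I, Prop. 2.2 (ii) / Prop. 4.4 (ii) for `C^birat`: conjugating the units `O^×(A^birat)`
# along isomorphisms of `C^birat` — existence, base-only dependence, divisors (proof-only)

Mochizuki, *The geometry of Frobenioids I: the general theory*, Kyushu J. Math. **62** (2008)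
293–400, §2 Prop. 2.2 (ii) pp. 45–46 ("depends only on `Base(φ)`", Def. 1.3 (iii)(c)), §4 Prop. 4.4
(ii)–(iv) p. 83, Def. 4.5 (i) p. 86, and the author's *Comments* (2024) item (29)(i)–(ii) (the rational
function monoid is the functor `O^×(−)` on `D` of `C^birat`, for `C` birationally Frobenius-normalized)
[cite: MochizukiFrdI2008, Prop. 4.4 (ii) p.83].

PROOF-ONLY piece A of row W15 `Thm52ivRationalFunctionMonoidExists` (L1-lead R89 (6); GAP-LEDGER
G-w4d020-1: the hypothesis structure `RationalFunctionMonoidStr` of abc-iut-L6-t8's `Thm52iv` is to be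
INHABITED for every Frobenioid of isotropic and model type). Over abc-iut-L6-t8's `BiratUnits` / `toHom` /
`Intertwines` / `push` / `transportHom` and abc-iut-L6-t20's `gpBase/gpDiv/gpDeg`, seat abc-iut-w4-d020:
* `exists_toHom_eq_of_isBaseIdentity_isLinear` — `O^▷(A^birat) = O^×(A^birat)`: a base-identity linear
  endomorphism of `A^birat` is a unit (no isotropy: Def. 1.3 (iii)(b));
* `exists_toHom_eq_conj` — along an isomorphism `g : A^birat ⥲ A′^birat` of `C^birat`, `g⁻¹ u g` is a
  unit of `A′^birat` for every unit `u` of `A^birat`;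
* `mul_comm_of_isBiratFrobeniusNormalized` — birational Frobenius-normalization of `A` (Def. 4.5 (i),
  degree-1 case) makes `O^×(A^birat)` ABELIAN;
* `eq_of_toHom_eq_conj_of_gpBase_eq` — **the conjugate depends only on the base map of `g`** when the
  target is birationally Frobenius-normalized (two isomorphisms with the same base differ by a
  base-identity automorphism = a unit, conjugating trivially on an abelian group); conversely base-only
  dependence forces `O^×(A^birat)` to have trivial inner automorphisms — which is why the W15 witness needs
  MODEL type, in line with the author's 2024 correction of Prop. 4.4 (ii);
* `divHom_eq_of_toHom_eq_conj` (`Div(g⁻¹ x g) = Base(g⁻¹)^* Div x`), `toHom_push_eq` (on a co-angular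
  pre-step conjugation is abc-iut-L6-t8's `push`), `divHom_eq_of_intertwines` / `divHom_transportHom`
  (`Div ∘ transport_ψ = Base(ψ)^* ∘ Div`), `transportHom_congr`;
* `Birat.exists_iso_of_baseIso` — over a base isomorphism `Base A₁ ⥲ Base A₂` there is an isomorphism
  `A₁^birat ⥲ A₂^birat` (isotropic type; Def. 1.3 (i)(b) + Prop. 1.4 (i) + Prop. 4.4 (iv)).
No statement of the paper is strengthened; nothing here bears on the disputed parts of [IUTchIII].
-/

namespace Literature.AlgebraicGeometry.Frobenioids

open CategoryTheory Opposite

namespace PreFrobenioid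

universe w v v' u u'

variable {D : Type u} [Category.{v} D] {Φ : Dᵒᵖ ⥤ CommMonCat.{w}}
  {C : Type u'} [Category.{v'} C] {F : C ⥤ ElemFrobenioid Φ}

namespace BiratUnits

variable {hF : IsFrobenioid F} {hsq : HasBiratSquares F} {A A' A'' : C}

/-! ### `O^▷(A^birat) = O^×(A^birat)`: base-identity linear endomorphisms are units -/

/-- A base-identity linear endomorphism of `A^birat` (for `C^birat → F_{0_D}`) is `φ ∘ α⁻¹` for a
rational function `[(α, φ)]`: `φ` is a pre-step base-equivalent to the co-angular pre-step `α`, hence a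
co-angular pre-step (Def. 1.3 (iii)(b)). In particular `O^▷(A^birat) = O^×(A^birat)`.
[cite: MochizukiFrdI2008, Prop. 4.4 (iv) p.83] -/
theorem exists_toHom_eq_of_isBaseIdentity_isLinear
    (k : (toBirat F hF hsq).obj A ⟶ (toBirat F hF hsq).obj A)
    (hb : (biratOps hF hsq).IsBaseIdentity k) (hl : (biratOps hF hsq).IsLinear k) :
    ∃ y : BiratUnits F hF A, toHom hsq y = k := by
  obtain ⟨f, hf⟩ : ∃ f : BiratFrac F A A, Birat.homMk f = k := Birat.homMk_surjective k
  haveI : IsIso (Base F f.den) := f.den_mem.2.2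
  have hbase : Base F f.num = Base F f.den := by
    have h : (biratOps hF hsq).base.map (Birat.homMk f) = 𝟙 _ := by rw [hf]; exact hb
    rw [biratOps_base_map_homMk] at h
    have h' : inv (Base F f.den) ≫ Base F f.num = 𝟙 (baseObj F A) := h
    rw [IsIso.inv_comp_eq, Category.comp_id] at h'
    exact h'
  have hdeg : degFr F f.num = 1 := by
    have h : (biratOps hF hsq).degFr (Birat.homMk f) = 1 := by rw [hf]; exact hl
    rwa [biratOps_degFr_homMk] at h
  have hnum : IsPreStep F f.num :=
    ⟨hdeg, by change IsIso (Base F f.num); rw [hbase]; infer_instance⟩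
  have hnum' : IsCoAngularPreStep F f.num := ⟨hF.iii_b f.den f.den_mem f.num, hnum⟩
  exact ⟨mk hF ⟨f.src, f.den, f.num, f.den_mem, hnum', hbase.symm⟩, by rw [toHom_mk]; exact hf⟩

/-! ### The `F_{Φ^gp}`-data of `toHom` -/

-- `gpBase_toHom`, `gpDeg_toHom`, `gpDiv_toHom` (the `F_{Φ^gp}`-data of `toHom x`) are abc-iut-L6-t8's
-- (`ModelFrobenioidComparisonFull2.lean`).

/-- Both directions of an isomorphism of `C^birat` between images of objects of `C` have Frobenius
degree `1`. [cite: MochizukiFrdI2008, Prop. 4.4 (iv) p.83] -/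
theorem gpDeg_iso_hom (g : (toBirat F hF hsq).obj A ≅ (toBirat F hF hsq).obj A') :
    Birat.gpDeg g.hom = 1 ∧ Birat.gpDeg g.inv = 1 := by
  have h : Birat.gpDeg g.hom * Birat.gpDeg g.inv = 1 := by
    rw [← Birat.gpDeg_comp, g.hom_inv_id]; exact degFr_id (Birat.toElemGp hF hsq) _
  have h' : (Birat.gpDeg g.hom : ℕ) * (Birat.gpDeg g.inv : ℕ) = 1 := by exact_mod_cast h
  exact ⟨PNat.coe_inj.mp (Nat.eq_one_of_mul_eq_one_right h'),
    PNat.coe_inj.mp (Nat.eq_one_of_mul_eq_one_left h')⟩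

/-- `Base(g⁻¹) ≫ Base(g) = id`. [cite: MochizukiFrdI2008, Prop. 4.4 (iv) p.83] -/
theorem gpBase_inv_comp_hom (g : (toBirat F hF hsq).obj A ≅ (toBirat F hF hsq).obj A') :
    Birat.gpBase g.inv ≫ Birat.gpBase g.hom = 𝟙 _ := by
  rw [← Birat.gpBase_comp, g.inv_hom_id]; exact base_id (Birat.toElemGp hF hsq) _

/-- `Base(g) ≫ Base(g⁻¹) = id`. [cite: MochizukiFrdI2008, Prop. 4.4 (iv) p.83] -/
theorem gpBase_hom_comp_inv (g : (toBirat F hF hsq).obj A ≅ (toBirat F hF hsq).obj A') :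
    Birat.gpBase g.hom ≫ Birat.gpBase g.inv = 𝟙 _ := by
  rw [← Birat.gpBase_comp, g.hom_inv_id]; exact base_id (Birat.toElemGp hF hsq) _

/-! ### Conjugating units along an isomorphism of `C^birat` -/

/-- The conjugate `g⁻¹ ≫ u ≫ g` of a unit `u` of `A^birat` along an isomorphism `g : A^birat ⥲ A'^birat`
is a unit of `A'^birat`. [cite: MochizukiFrdI2008, Prop. 2.2 (ii) p.45] -/
theorem exists_toHom_eq_conj (g : (toBirat F hF hsq).obj A ≅ (toBirat F hF hsq).obj A')
    (x : BiratUnits F hF A) :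
    ∃ y : BiratUnits F hF A', toHom hsq y = g.inv ≫ toHom hsq x ≫ g.hom := by
  apply exists_toHom_eq_of_isBaseIdentity_isLinear
  · change Birat.gpBase (g.inv ≫ toHom hsq x ≫ g.hom) = 𝟙 _
    rw [Birat.gpBase_comp, Birat.gpBase_comp, gpBase_toHom, Category.id_comp, gpBase_inv_comp_hom]
  · change Birat.gpDeg (g.inv ≫ toHom hsq x ≫ g.hom) = 1
    rw [Birat.gpDeg_comp, Birat.gpDeg_comp, gpDeg_toHom, (gpDeg_iso_hom g).1, (gpDeg_iso_hom g).2,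
      mul_one, mul_one]

/-! ### Birational Frobenius-normalization makes `O^×(A^birat)` abelian -/

/-- If `A` is birationally Frobenius-normalized (Def. 4.5 (i): `φ ≫ α^{deg φ} = α ≫ φ` on `A^birat`),
then `O^×(A^birat)` is COMMUTATIVE (the degree-`1` case of the normalization, `φ` a unit). This is the
point the author's Comments (2024), item (29)(ii), single out for `C^birat`.
[cite: MochizukiFrdI2008, Def. 4.5 (i) p.86] -/
theorem mul_comm_of_isBiratFrobeniusNormalized (hA : IsBiratFrobeniusNormalized F hF hsq A)
    (x y : BiratUnits F hF A) : x * y = y * x := by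
  have hb : IsBaseIdentity (Birat.toElemGp hF hsq) (toHom hsq y) := gpBase_toHom y
  have hmem : toHom hsq x ∈ endSubmonoid (Birat.toElemGp hF hsq) ((toBirat F hF hsq).obj A) :=
    ⟨gpBase_toHom x, gpDeg_toHom x⟩
  have h := hA (toHom hsq y) hb (toHom hsq x) hmem
  have hdeg : (degFr (Birat.toElemGp hF hsq) (toHom hsq y) : ℕ) = 1 := by
    rw [show degFr (Birat.toElemGp hF hsq) (toHom hsq y) = 1 from gpDeg_toHom y]; rfl
  rw [hdeg, pow_one] at h
  -- `h : toHom y ≫ toHom x = toHom x ≫ toHom y`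
  apply toHom_injective (hsq := hsq)
  rw [toHom_mul, toHom_mul]
  exact h

/-! ### Base-only dependence -/

/-- **Transport of units depends only on the base map** (Prop. 2.2 (ii) for `C^birat`; print's
"depends only on `Base(φ)`" of Def. 1.3 (iii)(c)): if `y₁ = g₁⁻¹ x g₁` and `y₂ = g₂⁻¹ x g₂` for two
isomorphisms `g₁, g₂ : A^birat ⥲ A'^birat` with the same base map, then `y₁ = y₂` — the base-identity
automorphism `g₁⁻¹ g₂` of `A'^birat` is a unit (`exists_toHom_eq_of_isBaseIdentity_isLinear`) and
conjugates trivially on `O^×(A'^birat)`, which is ABELIAN when `A'` is birationally Frobenius-normalized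
(Def. 4.5 (i)). [cite: MochizukiFrdI2008, Prop. 2.2 (ii) p.46] -/
theorem eq_of_toHom_eq_conj_of_gpBase_eq (hA' : IsBiratFrobeniusNormalized F hF hsq A')
    {g₁ g₂ : (toBirat F hF hsq).obj A ≅ (toBirat F hF hsq).obj A'}
    (h : Birat.gpBase g₁.hom = Birat.gpBase g₂.hom) {x : BiratUnits F hF A} {y₁ y₂ : BiratUnits F hF A'}
    (h₁ : toHom hsq y₁ = g₁.inv ≫ toHom hsq x ≫ g₁.hom) (h₂ : toHom hsq y₂ = g₂.inv ≫ toHom hsq x ≫ g₂.hom) :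
    y₁ = y₂ := by
  -- the base-identity automorphism `k = g₁⁻¹ ≫ g₂` of `A'^birat` is a unit `y₀`
  obtain ⟨y₀, hy₀⟩ : ∃ y₀ : BiratUnits F hF A', toHom hsq y₀ = g₁.inv ≫ g₂.hom := by
    apply exists_toHom_eq_of_isBaseIdentity_isLinear
    · change Birat.gpBase (g₁.inv ≫ g₂.hom) = 𝟙 _
      rw [Birat.gpBase_comp, ← h, gpBase_inv_comp_hom]
    · change Birat.gpDeg (g₁.inv ≫ g₂.hom) = 1
      rw [Birat.gpDeg_comp, (gpDeg_iso_hom g₁).2, (gpDeg_iso_hom g₂).1, mul_one]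
  have e₁ : g₂.hom = g₁.hom ≫ toHom hsq y₀ := by rw [hy₀, g₁.hom_inv_id_assoc]
  have e₂ : toHom hsq y₀ ≫ g₂.inv = g₁.inv := by rw [hy₀, Category.assoc, g₂.hom_inv_id, Category.comp_id]
  -- `toHom y₀ ≫ toHom y₂ = toHom y₁ ≫ toHom y₀`
  have key : toHom hsq y₀ ≫ toHom hsq y₂ = toHom hsq y₁ ≫ toHom hsq y₀ := by
    rw [h₁, h₂, e₁, ← Category.assoc (toHom hsq y₀), e₂]
    simp only [Category.assoc]
  rw [← toHom_mul, ← toHom_mul] at key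
  have key' : y₂ * y₀ = y₀ * y₁ := toHom_injective (hsq := hsq) key
  have key'' : y₂ * y₀ = y₁ * y₀ := key'.trans (mul_comm_of_isBiratFrobeniusNormalized hA' y₀ y₁)
  exact (mul_right_cancel key'').symm

/-! ### Divisors under transport -/

/-- **Divisors are pulled back along the base map**: if `y = g⁻¹ x g` along an isomorphism
`g : A^birat ⥲ A'^birat`, then `Div(y) = Base(g⁻¹)^* Div(x)` (the 1-commutativity of `C^birat → F_{Φ^gp}`
over `D`). [cite: MochizukiFrdI2008, Prop. 4.4 (i) p.83] -/
theorem divHom_eq_of_toHom_eq_conj {g : (toBirat F hF hsq).obj A ≅ (toBirat F hF hsq).obj A'}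
    {x : BiratUnits F hF A} {y : BiratUnits F hF A'} (hy : toHom hsq y = g.inv ≫ toHom hsq x ≫ g.hom) :
    divHom hF A' y = pullGp Φ (Birat.gpBase g.inv) (divHom hF A x) := by
  have hdeg1 : Birat.gpDeg (toHom hsq x ≫ g.hom) = 1 := by
    rw [Birat.gpDeg_comp, gpDeg_toHom, (gpDeg_iso_hom g).1, mul_one]
  have hdiv1 : Birat.gpDiv (toHom hsq x ≫ g.hom) = Birat.gpDiv g.hom * divHom hF A x := by
    rw [Birat.gpDiv_comp, gpBase_toHom, pullGp_id, (gpDeg_iso_hom g).1, PNat.one_coe, pow_one,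
      gpDiv_toHom]
  -- `1 = Div(g⁻¹ ≫ g) = Base(g⁻¹)^* Div g · Div g⁻¹`
  have hone : pullGp Φ (Birat.gpBase g.inv) (Birat.gpDiv g.hom) * Birat.gpDiv g.inv = 1 := by
    have h := Birat.gpDiv_comp (hF := hF) (hsq := hsq) g.inv g.hom
    rw [g.inv_hom_id, (gpDeg_iso_hom g).1, PNat.one_coe, pow_one] at h
    rw [← h]
    exact PreFrobenioid.div_id (Birat.toElemGp hF hsq) _
  rw [← gpDiv_toHom (hsq := hsq) y, hy, Birat.gpDiv_comp, hdeg1, PNat.one_coe, pow_one, hdiv1, map_mul]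
  calc pullGp Φ (Birat.gpBase g.inv) (Birat.gpDiv g.hom) *
        pullGp Φ (Birat.gpBase g.inv) (divHom hF A x) * Birat.gpDiv g.inv
      = pullGp Φ (Birat.gpBase g.inv) (Birat.gpDiv g.hom) * Birat.gpDiv g.inv *
          pullGp Φ (Birat.gpBase g.inv) (divHom hF A x) := mul_right_comm _ _ _
    _ = pullGp Φ (Birat.gpBase g.inv) (divHom hF A x) := by rw [hone, one_mul]

/-! ### Transport along co-angular pre-steps is `push` -/

/-- Along the isomorphism `ψ^birat` of a co-angular pre-step `ψ : A → A'` of `C`, conjugation is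
abc-iut-L6-t8's `push` (`[(α, φ)] ↦ [(α ≫ ψ, φ ≫ ψ)]`): `toHom (push ψ x) = (ψ^birat)⁻¹ ≫ toHom x ≫ ψ^birat`.
[cite: MochizukiFrdI2008, Prop. 2.2 (ii) p.45] -/
theorem toHom_push_eq (ψ : A ⟶ A') (hψ : IsCoAngularPreStep F ψ) (x : BiratUnits F hF A) :
    haveI := Birat.isIso_toBirat_map (hF := hF) (hsq := hsq) ψ hψ
    toHom hsq (push hF ψ hψ x) =
      inv ((toBirat F hF hsq).map ψ) ≫ toHom hsq x ≫ (toBirat F hF hsq).map ψ := by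
  haveI := Birat.isIso_toBirat_map (hF := hF) (hsq := hsq) ψ hψ
  have h := (intertwines_iff_toHom_comm hsq ψ x (push hF ψ hψ x)).mp
    ((intertwines_iff_push_eq ψ hψ x _).mpr rfl)
  rw [IsIso.eq_inv_comp, h]

/-! ### Transport along linear morphisms: congruence and divisors -/

/-- `transportHom` only depends on the arrow (congruence in the dependent linearity argument).
[cite: MochizukiFrdI2008, Prop. 2.2 (ii) p.45] -/
theorem transportHom_congr (hiso : IsOfIsotropicType F) {A A' : C} {ψ ψ' : A ⟶ A'} (h : ψ = ψ')
    (hψ : IsLinear F ψ) (hψ' : IsLinear F ψ') (v : BiratUnits F hF A') :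
    transportHom hF hsq hiso ψ hψ v = transportHom hF hsq hiso ψ' hψ' v := by
  subst h; rfl

/-- Divisors along a transport: if `u` intertwines with `v` along the linear `ψ` ("`ψ ∘ u = v ∘ ψ`" in
`C^birat`), then `Div u = Base(ψ)^* Div v` (Prop. 4.4 (i): `C^birat → F_{Φ^gp}` lies over `D`).
[cite: MochizukiFrdI2008, Prop. 4.4 (i) p.83] -/
theorem divHom_eq_of_intertwines (hsq : HasBiratSquares F) {A A' : C} {ψ : A ⟶ A'} (hψ : IsLinear F ψ)
    {u : BiratUnits F hF A} {v : BiratUnits F hF A'} (h : Intertwines hF ψ u v) :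
    divHom hF A u = pullGp Φ (Base F ψ) (divHom hF A' v) := by
  have e := congrArg Birat.gpDiv ((intertwines_iff_toHom_comm hsq ψ u v).mp h)
  rw [Birat.gpDiv_comp, Birat.gpDiv_comp, gpBase_toHom, pullGp_id, Birat.gpDeg_map,
    show degFr F ψ = 1 from hψ, PNat.one_coe, pow_one, gpDiv_toHom, gpDeg_toHom, PNat.one_coe,
    pow_one, Birat.gpBase_map, gpDiv_toHom, mul_comm] at e
  exact mul_right_cancel e

/-- `Div (transportHom ψ v) = Base(ψ)^* Div v`. [cite: MochizukiFrdI2008, Prop. 4.4 (i) p.83] -/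
theorem divHom_transportHom (hiso : IsOfIsotropicType F) {A A' : C} (ψ : A ⟶ A') (hψ : IsLinear F ψ)
    (v : BiratUnits F hF A') :
    divHom hF A (transportHom hF hsq hiso ψ hψ v) = pullGp Φ (Base F ψ) (divHom hF A' v) :=
  divHom_eq_of_intertwines hsq hψ (intertwines_transportHom hiso ψ hψ v)

end BiratUnits

/-! ### Isomorphisms of `C^birat` over a given base isomorphism -/

namespace Birat

variable {hF : IsFrobenioid F} {hsq : HasBiratSquares F}

/-- Over a base isomorphism `θ : Base A₁ ⥲ Base A₂` there is an isomorphism `A₁^birat ⥲ A₂^birat` of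
`C^birat` (isotropic type): Def. 1.3 (i)(b) gives pre-steps `φ : X → A₁`, `ψ : X → A₂` with
`Base ψ = Base φ ≫ θ`, co-angular by Prop. 1.4 (i), hence invertible in `C^birat`; take `(φ^birat)⁻¹ ≫ ψ^birat`.
[cite: MochizukiFrdI2008, Prop. 2.2 (ii) p.46] -/
theorem exists_iso_of_baseIso (hiso : IsOfIsotropicType F) (A₁ A₂ : C) (θ : baseObj F A₁ ≅ baseObj F A₂) :
    ∃ g : (toBirat F hF hsq).obj A₁ ≅ (toBirat F hF hsq).obj A₂, gpBase g.hom = θ.hom := by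
  obtain ⟨X, φ, ψ, hφ, hψ, hθ⟩ := hF.i_b A₁ A₂ θ
  haveI := isIso_toBirat_map (hF := hF) (hsq := hsq) φ (isCoAngularPreStep_of_isotropic hiso hφ)
  haveI := isIso_toBirat_map (hF := hF) (hsq := hsq) ψ (isCoAngularPreStep_of_isotropic hiso hψ)
  haveI : IsIso (Base F φ) := hφ.2
  refine ⟨(asIso ((toBirat F hF hsq).map φ)).symm ≪≫ asIso ((toBirat F hF hsq).map ψ), ?_⟩
  have hinv : gpBase (inv ((toBirat F hF hsq).map φ)) = inv (Base F φ) := by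
    apply IsIso.eq_inv_of_hom_inv_id
    rw [← gpBase_map (hF := hF) (hsq := hsq) φ, ← gpBase_comp, IsIso.hom_inv_id]
    exact base_id (toElemGp hF hsq) _
  change gpBase (inv ((toBirat F hF hsq).map φ) ≫ (toBirat F hF hsq).map ψ) = θ.hom
  rw [gpBase_comp, hinv, gpBase_map, IsIso.inv_comp_eq, hθ]

end Birat

end PreFrobenioid

end Literature.AlgebraicGeometry.Frobenioids
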